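import Literature.NumberTheory.EllipticCurves.CastellaGrossiSkinner2025.HeegnerPointMainConjecture
import HarnessLib

/-!
# Keller–Yin (arXiv:2402.12781v2), Theorem B (= Thm. 3.0.8 (IMC1) with Remark 3.0.9): Perrin-Riou's
# Heegner point main conjecture at a GOOD Eisenstein prime `p > 2`, `p` split in `K`, WITHOUT the
# non-anomaly hypothesis `φ|_{G_p} ≠ 𝟙, ω` — the elliptic-curve case, as an explicitly labelled OPEN
# hypothesis (UNREFEREED PREPRINT), in the vocabulary of the tree's Castella–Grossi–Skinner Theorem C

HONEST FRAMING (cell `bsd-littype`, seat `bsd-littype-05`; cross-ladder LITERATURE-TYPING layer,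
D-0088(4): typed ≠ proved ≠ endorsed). T. Keller, M. Yin, *On the anticyclotomic Iwasawa theory of
newforms at Eisenstein primes of semistable reduction*, arXiv:2402.12781v2 (2024-10-30) is an
UNREFEREED PREPRINT. Nothing in this file is a theorem about elliptic curves: the one `def … : Prop`
below TRANSCRIBES, for an elliptic curve over `ℚ` (the case `k = 2`, `r = 1` (odd), `ℤ[f] = ℤ`,
`A_f = E`), the Introduction's **Theorem B** (TeX label `Heeg imc`, restating Thm. 3.0.8 `IMC`,
statement (IMC1); arXiv v1 "Theorem 2" = "Thm. 3.0.11 (IMC1)"), with the suffix `_OPEN` and the tag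
`[claim: KellerYin2024, status: under-review]` (D-0012), to be taken as an explicit hypothesis;
everything else is PROVED bookkeeping. It is typed in EXACTLY the vocabulary of the PUBLISHED sibling
`CastellaGrossiSkinner2025.thmC_charIdeal_torsion_eq_heegnerCharIdeal_sq` (Math. Ann. 393 (2025)
Theorem C = the same statement under the extra hypothesis `φ|_{G_p} ≠ 𝟙, ω`, file
`CastellaGrossiSkinner2025/HeegnerPointMainConjecture.lean`): `LambdaAdicSelmerData` (`𝔖 =
H¹_{𝓕_Λ}(K, 𝐓)`), `SelmerDualData` (`𝒳 = H¹_{𝓕_Λ}(K, M_f)^∨`), `HeegnerFamily` / `heegnerCharIdeal`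
(`char_Λ(𝔖/Λκ_∞)`), so that the claim and the published theorem are comparable in the kernel:
`thmC_of_thmB_OPEN` (the claim CONTAINS Theorem C) and `thmB_OPEN_of_thmC_of_not_anom` (at a
non-anomalous prime the claim IS Theorem C) — the OPEN content is precisely the anomalous case
`a_p ≡ 1 (mod p)`. Companions in this directory: Theorem A = (IMC2) read at `𝟙`
(`thm308_imc2_bdpValue_goodLattice_OPEN`), Theorems C/D/E (`AnomalousBSD.lean`,
`MultiplicativeReduction.lean`), Thm. 3.0.10 (`CyclotomicMainConjecture.lean`).

## The source, verbatim (v2 TeX of record `run/shared/lean/pub/bsd-eis/lit/src/ky24-v2/main.tex`,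
## PDF pages from `…/PAGEMAP-v2.md`)

* **Theorem B** (§0.2, TeX L283–L291, v2 PDF p. 4): "Let `f ∈ S_k(Γ_0(N))` be a newform of weight
  `k = 2r` where `r` is odd and `p > 2` an ordinary Eisenstein prime not dividing `N`, and let `K` be
  an imaginary quadratic field satisfying the hypotheses in §0.1. Then both `H¹_{𝓕_Λ}(K, 𝐓)` and
  `𝒳 = H¹_{𝓕_Λ}(K, M_f)^∨` have `Λ`-rank one (see [CGLS, section 3] for general definitions), and
  the equality `Char_Λ(𝒳_tors) = Char_Λ(H¹_{𝓕_Λ}(K, 𝐓)/Λκ_∞)²` holds in `Λ`." §0.1 (L233–L235):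
  "`K/ℚ` a Heegner field for `N`, i.e., an imaginary quadratic field such that all primes dividing
  `N` split completely in `K` … `D_K` is odd and `≠ −3`, and … `p = v v̄` splits in `K`."
* = **Theorem 3.0.8** (label `IMC`, L1618–L1629, PDF p. 40): "Assume `f` has weight `2r` where `r`
  is odd. Assume that `p = v v̄` splits in `K` and `H⁰(K, ρ̄_f) = 0`. Then … (IMC1) Both
  `H¹_{𝓕_Λ}(K, 𝐓)` and `𝒳 = H¹_{𝓕_Λ}(K, M_f)^∨` have `Λ`-rank one, and the equality
  `Char_Λ(𝒳_tors) = Char_Λ(H¹_{𝓕_Λ}(K, 𝐓)/Λκ_∞)²` holds in `Λ_ac`." with **Remark 3.0.9**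
  (`allowtor`, L1645–L1647): "As is explained in the beginning of §1.4, the above theorem still holds
  without assuming `H⁰(K, ρ̄_f) = 0`" (any lattice, i.e. every curve of the isogeny class), and the
  sentence before Thm. 3.0.8 (L1615–L1616): "as is noted in [CGLS, Remark 4.1.3], `κ_∞` and `κ_1`
  generate the same `Λ`-submodule in `H¹_{𝓕_Λ}(K, 𝐓)`". Printed proof (L1631–L1643): Kolyvagin
  system from generalized Heegner cycles (Thm. 3.0.6 `Koly`, the only use of "`r` odd", Rem. 3.0.7)
  ⇒ one divisibility of (IMC1) (Thm. 3.0.5 `HeegMC`, after [CGLS] Thm. 3.4.1 / [CGS, §6]) ⇒ a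
  divisibility of (IMC2) ([CGLS, Prop. 4.2.1], [BCK21, Thm. 5.2]) ⇒ equality by the `λ`/`μ`
  comparison (Thm. 1.5.1 `algmain`, Thm. 2.2.3 `anacomp`) ⇒ (IMC1); at an anomalous prime the
  classes are first scaled by a fixed `p^{t+N}` ((IMC1′)/(IMC2′), L1636–L1642) and the scaling is
  removed by the same `λ`/`μ` equality.

## Transcription (tree vocabulary only; nothing re-declared) — VERBATIM the dictionary of the sibling
## `CastellaGrossiSkinner2025/HeegnerPointMainConjecture.lean` (module docstring items 1–7 there),
## with ONE hypothesis removed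

* `ThmBHypotheses N W K p κ γ` := the sibling's `ThmCHypotheses N W K p κ γ` WITHOUT the field
  `not_anom : ¬ Anom W p` ("`φ|_{G_p} ≠ 𝟙, ω`") — that removal is the whole printed content of
  Theorem B over Theorem C (§0.6, L344–L346: "direct generalizations of those in [CGLS] … while
  removing the technical condition `θ|_{G_p} ≠ 𝟙, ω`. Thus it would automatically generalize …
  [CGS, Theorem A]"); with it goes the sibling's `[W.IsGloballyMinimal]` (needed there only to read
  `a_p`; here `W` is any model of `E`, minimality entering only the comparison lemmas of §2). Kept:
  `E` elliptic of conductor `N`; "`p > 2` an ordinary Eisenstein prime not dividing `N`" — `2 < p`,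
  `Good W p`, `Red W p` (ordinarity automatic, `goodOrd_of_red_of_good`);
  (Heeg), (disc), (spl); `κ` anticyclotomic with topological generator `γ`; AND the sibling's EXTRA
  standing hypothesis `p ∤ h_K` of the tree's Heegner-family vocabulary (Howard 2004 Thm. 3.3.7:
  `heegnerModule D F = Λκ̃_1`; not printed by KY, who "do not assume `p ∤ h_K`", L1573 — special
  case, `-- TODO(general form)` below).
* Conclusion — for every `Λ`-adic Selmer datum `D` (`𝔖 = H¹_{𝓕_Λ}(K, 𝐓)`), Heegner family `F` at
  level `N = N_E` and Selmer-dual datum `X` (`𝒳`) of `E/K` along `κ`: `𝔖`, `𝒳` finitely generated of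
  `Λ`-rank one and `char_Λ(𝒳_tors) = char_Λ(𝔖/𝐇)²` — literally the sibling's conclusion.

## Flags for the registry / D-audit (nothing hidden)

* `KYB-Lambda`: the Introduction (Theorem B, L291) prints "holds in `Λ`"; the body (Thm. 3.0.8
  (IMC1), L1625) prints "holds in `Λ_ac`", a symbol used nowhere else in the paper (in [CGLS] Thm.
  4.1.2 `Λ_ac = Λ[1/p]`); KY's Thm. 3.0.5 proof (L1562–L1563): "in the aforementioned papers the
  divisibilities hold only after inverting `p` … but the computation works for the prime `p` too
  ([How2004, Theorem 2.2.10])". Transcribed as printed in Theorem B: an equality of ideals of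
  `Λ = IwasawaAlgebra p` (the sibling's `Module.charIdeal`), the STRONGER reading if `Λ_ac` meant
  `Λ[1/p]`.
* `KYB-hK`: `p ∤ h_K` is EXTRA (tree vocabulary), exactly as in the sibling; KY allow `p ∣ h_K`.
* `KYB-kappa`: `Λκ_∞` = `Λκ_1^{Hg}` ([CGLS] Rem. 4.1.3, quoted by KY L1615) = Howard's Heegner module
  `𝐇` (`heegnerModule D F`, Howard 2004 Thm. 3.3.7 under `p ∤ h_K`), as in the sibling (item 6 there).

## Contents (all in `namespace Literature.NumberTheory.EllipticCurves.KellerYin2024`)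

* `ThmBHypotheses` (structure, `Prop`) and `thmB_imc1_charIdeal_torsion_eq_heegnerCharIdeal_sq_OPEN`
  — Theorem B (ONE new named `Prop`).
* PROVED: `ThmBHypotheses.of_thmC`, `ThmBHypotheses.toThmC` (the two hypothesis bundles differ
  exactly by `¬ Anom W p`), `ThmBHypotheses.p_ne_two_and_goodOrd`, `thmC_of_thmB_OPEN` (the claim
  contains the PUBLISHED Theorem C), `thmB_OPEN_of_thmC_of_not_anom` (at a non-anomalous `p` the
  claim follows from Theorem C — its open content is the anomalous case),
  `charIdeal_torsion_dvd_of_thmB_OPEN` / `heegnerCharIdeal_sq_dvd_of_thmB_OPEN` (the two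
  divisibilities, Howard-Theorem-B shape).

## References
* [KellerYin2024] arXiv:2402.12781v2: Theorem B (L283–L291) = Thm. 3.0.8 (IMC1) (L1618–L1629),
  Rem. 3.0.9 (L1645–L1647), Thms. 3.0.5–3.0.6 (L1554–L1609), Rem. 3.0.7, §0.1 (L233–L235), §0.6
  (L344–L346); arXiv v1 numbering "Thm. 2" / "Thm. 3.0.11" (tree `AnomalousBSD.lean` VERSION NOTE).
* [CastellaGrossiSkinner2025] Math. Ann. 393 (2025): Conjecture 2, Theorem C = Cor. 5.5.4 (tree
  sibling, whose dictionary is reused verbatim). [CastellaGrossiLeeSkinner2022] Invent. Math. 227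
  (2022): Cor. D = Cor. 4.2.3, Rem. 4.1.3, Prop. 4.2.1. [Howard2004HeegnerKolyvagin] Thm. B, Thm.
  3.3.7 (tree `HeegnerModuleIndex.lean`). [BurungaleCastellaKim2021] Thm. 5.2.
* Cell documents: `run/shared/lean/pub/bsd-littype/staging/bsd-littype-05/{LOCATOR,FAITHFULNESS}-05.md`,
  `run/shared/lean/pub/bsd-littype/OPEN-QUESTIONS-05.md`.
-/

set_option autoImplicit false

noncomputable section

open scoped Classical

open WeierstrassCurve NumberField IsDedekindDomain Literature.NumberTheory.EllipticCurves
  Literature.NumberTheory.EllipticCurves.Rank1Residual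
  Literature.NumberTheory.EllipticCurves.CastellaGrossiSkinner2025

universe u

namespace Literature.NumberTheory.EllipticCurves.KellerYin2024

variable (N : ℕ) [NeZero N] (W : WeierstrassCurve ℚ) (K : Type u) [Field K] [NumberField K]
  (p : ℕ) [Fact p.Prime] (κ : ZpExtension K p) (γ : Field.absoluteGaloisGroup K)
  (jbar : AlgebraicClosure K →+* ℂ)

/-- **Hypotheses of Keller–Yin, Theorem B (= Thm. 3.0.8 (IMC1) + Rem. 3.0.9) for an elliptic curve**
in the tree's vocabulary — the sibling bundle `CastellaGrossiSkinner2025.ThmCHypotheses` with the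
field `not_anom` ("`φ|_{G_p} ≠ 𝟙, ω`") REMOVED: `E/ℚ` elliptic with conductor `N` (the level of the
Heegner family); "`p > 2` an ordinary Eisenstein prime not dividing `N`" (`2 < p`, `Good W p`,
`Red W p`; ordinarity is automatic); `K` imaginary quadratic with (Heeg) "all primes dividing `N`
split completely in `K`", (disc) "`D_K` is odd and `≠ −3`", (spl) "`p = v v̄` splits in `K`" (§0.1);
`κ` the anticyclotomic `ℤ_p`-extension with topological generator `γ`; and the EXTRA standing
hypothesis `p ∤ h_K` of the tree's Heegner-family vocabulary / Howard 2004 Thm. 3.3.7 (flag `KYB-hK`;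
not printed by KY — special case). [claim: KellerYin2024, status: under-review]
[cite: CastellaGrossiSkinner2025, Theorem C (§0.1) hypotheses (Heeg), (disc), (spl) (the bundle reused; shape only)] -/
structure ThmBHypotheses : Prop where
  /-- `E` is an elliptic curve. -/
  isElliptic : W.IsElliptic
  /-- `N` is the conductor of `E`. -/
  level : N = W.conductorNorm ℤ
  /-- `p > 2`. -/
  two_lt : 2 < p
  /-- `p` is a prime of good reduction ("not dividing `N`"). -/
  good : Good W p
  /-- `p` is Eisenstein: `E[p]` is reducible. -/
  red : Red W p
  /-- `K` is imaginary quadratic. -/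
  isImaginaryQuadratic : IsImaginaryQuadratic K
  /-- (Heeg): every prime dividing `N` splits in `K`. -/
  heegner : SatisfiesHeegnerHypothesis N K
  /-- (disc), first half: `D_K` is odd. -/
  discr_odd : Odd (discr K)
  /-- (disc), second half: `D_K ≠ -3`. -/
  discr_ne : discr K ≠ -3
  /-- (spl): `p` splits in `K`. -/
  split : ((Ideal.span {(p : ℤ)}).primesOver (𝓞 K)).ncard = 2
  /-- EXTRA (special case, Howard 2004 Thm. 3.3.7 / tree Heegner families): `p ∤ h_K`. -/
  not_dvd_classNumber : ¬ p ∣ classNumber K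
  /-- `κ` is the anticyclotomic `ℤ_p`-extension of `K`. -/
  anticyclotomic : κ.IsAnticyclotomic
  /-- `γ` is a topological generator of `Gal(K_∞/K)`. -/
  topGenerator : κ.IsTopGenerator γ

-- TODO(general form): KY Theorem B allows `p ∣ h_K` ("we do not assume `p ∤ h_K`", L1573), newforms
-- of weight `2r` (`r` odd) and arbitrary coefficient rings; the field `not_dvd_classNumber` is the
-- tree vocabulary's (Howard 2004 §3.3) standing hypothesis, as in the sibling `ThmCHypotheses`.

/-- **OPEN HYPOTHESIS — UNREFEREED PREPRINT (Keller–Yin, arXiv:2402.12781v2, Theorem B of the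
Introduction = Theorem 3.0.8, statement (IMC1), with Remark 3.0.9).** Verbatim (v2 TeX L283–L291):
"Let `f ∈ S_k(Γ_0(N))` be a newform of weight `k = 2r` where `r` is odd and `p > 2` an ordinary
Eisenstein prime not dividing `N`, and let `K` be an imaginary quadratic field satisfying the
hypotheses in §0.1. Then both `H¹_{𝓕_Λ}(K, 𝐓)` and `𝒳 = H¹_{𝓕_Λ}(K, M_f)^∨` have `Λ`-rank one …,
and the equality `Char_Λ(𝒳_tors) = Char_Λ(H¹_{𝓕_Λ}(K, 𝐓)/Λκ_∞)²` holds in `Λ`." TRANSCRIBED for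
`A_f = E` an elliptic curve over `ℚ` (`k = 2`, `r = 1`), in the vocabulary of the PUBLISHED sibling
`CastellaGrossiSkinner2025.thmC_charIdeal_torsion_eq_heegnerCharIdeal_sq` (Math. Ann. 393 (2025)
Theorem C: the same conclusion under the extra hypothesis `φ|_{G_p} ≠ 𝟙, ω`): under `ThmBHypotheses`
(the sibling's bundle minus `not_anom`; the special case `p ∤ h_K`), for every `Λ`-adic Selmer datum
`D` (`𝔖 = H¹_{𝓕_Λ}(K, 𝐓) = lim← lim← Sel_{p^m}(E/K_n)`, `D.S`), Heegner family `F` at level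
`N = N_E` (`Λκ_∞ = Λκ_1^{Hg}` = Howard's Heegner module, so `char(𝔖/Λκ_∞) = heegnerCharIdeal D F`)
and Selmer-dual datum `X` (`𝒳 = Sel_{p^∞}(E/K_∞)^∨`, `X.X`): `𝔖` finitely generated of `Λ`-rank one,
`𝒳` finitely generated of `Λ`-rank one, and `char_Λ(𝒳_tors) = char_Λ(𝔖/𝐇)²` in `Λ = ℤ_p⟦T⟧` (flag
`KYB-Lambda`: the body's (IMC1) prints "in `Λ_ac`"). The claim CONTAINS Theorem C
(`thmC_of_thmB_OPEN`) and follows from it at a non-anomalous prime (`thmB_OPEN_of_thmC_of_not_anom`):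
its open content is the anomalous case `a_p ≡ 1 (mod p)`. NEVER cite this `Prop` as a theorem: take
it as an explicit hypothesis; a result using it is conditional on an unrefereed claim.
[claim: KellerYin2024, status: under-review]
[cite: CastellaGrossiSkinner2025, Theorem C (§0.1) = Cor. 5.5.4 (the transcription reused; shape only)]
[cite: Howard2004HeegnerKolyvagin, Thm. 3.3.7 (transcription of Λκ_∞ as the Heegner module 𝐇)] -/
def thmB_imc1_charIdeal_torsion_eq_heegnerCharIdeal_sq_OPEN : Prop :=
  ∀ (_ : ThmBHypotheses N W K p κ γ) (D : (W.baseChange K).LambdaAdicSelmerData κ γ)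
    (F : HeegnerFamily N W K κ jbar) (X : (W.baseChange K).SelmerDualData κ γ),
    (Module.Finite (IwasawaAlgebra p) D.S ∧ Module.finrank (IwasawaAlgebra p) D.S = 1) ∧
    (Module.Finite (IwasawaAlgebra p) X.X ∧ Module.finrank (IwasawaAlgebra p) X.X = 1 ∧
      Module.charIdeal (IwasawaAlgebra p) (Submodule.torsion (IwasawaAlgebra p) X.X) =
        heegnerCharIdeal D F ^ 2)

/-- **Keller–Yin, Theorem B (IMC1) — PINNED to a minimal-degree parametrisation with `p`-ADIC-UNIT MANIN CONSTANT** (BSD cited-literature audit ARM P, REGISTER R-15 / TY-QUEUE 25; reader bsd-cited-r19 sheets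
`D-AUDIT-r19-ADDENDUM-5.md` sha16 6a0e68f1a5f0faa2 §4, ADDENDUM-6 c1c6b9e51d6d0dd9 and ADDENDUM-8
24e75636994fcc95 (v2) §4 (the Manin pin, rider R-b of r17 ADDENDUM-4 0434952c634f1c51); typer bsd-cited-ty4 g7/g8/g10,
2026-08-27; lead rulings (181)/(198)/(243) + RULING (316) «TYQ 25: kit v5.2 is the release shape»): the statement of
`thmB_imc1_charIdeal_torsion_eq_heegnerCharIdeal_sq_OPEN` (kept byte-identical above) with TWO extra hypotheses as binders right after `F` and the instance
binder `[W.IsGloballyMinimal]` (`F.Dt.c` is the Manin constant w.r.t. a NÉRON differential only on a globally minimal model —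
`ModularCurve.lean` `isNeronLattice`/`c`; r19 ADD-8 §1.1):
(F1) `∀ Dt', F.Dt.deg ≤ Dt'.deg` — minimal modular degree among the data of the same curve and level (`φ = ±φ_min`) =
VERBATIM the body of `ModularForms.ModularParametrizationData.IsMinimal F.Dt` (`ModularParametrizationScalingProofs.lean`,
p482958: `exists_isMinimal`, `IsMinimal.deg_eq`, `not_isMinimal_zsmul`), spelled out because that module lies DOWNSTREAM of
this file (an `import` would close a cycle); the two agree by `Iff.rfl` — kernel lemma `TYQ25Check.pin_iff_isMinimal_heegnerFamily`
of the kit file `run/shared/lean/pub/bsd-cited/staging/bsd-cited-ty4/TYQ25-kit/check/K_TYQ25_pin_iff_isMinimal.lean` sha16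
3e421a28abe396fd (imports both modules; farm rc 0, axioms trio; lead (243)).
(F1′, the MANIN PIN) `¬ (p : ℤ) ∣ F.Dt.c` — the Manin constant of `φ` (`φ^*ω_W = c · 2πi f dτ`) is a `p`-adic unit:
Perrin-Riou's Conj. B carries the factor `c_π · (#𝒪_K^× / 2)` [PR87 §1 p. 405; BCK21 Rem. after Conj. 1], which the `c`-free
form printed here drops exactly when it is a `p`-adic unit (Mazur 1978 Cor. 4.1 for the OPTIMAL curve; NOT automatic for a
non-optimal curve at an Eisenstein `p` — PR87 p. 409 Ex. 3, `X_0(11)/μ_5` at `p = 5`); inside the pin the statement does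
not depend on the parametrisation (r19 ADD-8 kernel `sheets/r19-add8/d_audit_r19_add8_manin_pin_check.lean` f8a7d8f730b7607f,
K2 `nonsplitClause_iff_zsmul` / `charIdeal_quot_span_C_smul_eq_of_not_dvd`, K3 shapes `…ManinPinned`; TREE theorems
`heegnerCharIdeal_zsmul_of_not_dvd` / `heegnerModule_zsmul_of_not_dvd` / `charIdeal_quotient_span_C_smul_eq_of_not_dvd` of
`HeegnerModuleScalingProofs.lean`, p496710 — downstream of this file), outside it the `∀ F`
layout is refuted (p482958), and on `S_bad(p) = {W : p ∣ c(π_min W)}` the twin is vacuous (no `c`-free integral statement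
is in print there — r19 ADD-8 §0 (a)/(b), §3). WHY: print works with ONE fixed parametrisation (the optimal quotient `A_f` and its Heegner classes `κ_∞` of §3, in the layout of [CGS25] «Heegner points on `E` associated with a given modular parametrization `π : X_0(N) → E`», TeX l.452–455), whereas `∀ (F : HeegnerFamily …)` ranges over every
rescaling `[m] ∘ φ` of it (`F.Dt.c ↦ m · F.Dt.c`; points and `Λ`-adic class scale by `m` — kernel theorems
`HeegnerFamily.zsmul` / `KellerYin2024.false_of_thm521_OPEN_zsmul` (p481261), `HeegnerFamily.zsmulSelf` /
`false_of_thm521_OPEN_of_witness` (p482958)), and an INTEGRAL equality of characteristic ideals cannot hold for a class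
and its `p`-multiple at once (`char_Λ(𝔖/Λpz) = (p) · char_Λ(𝔖/Λz)`): the unpinned binder above is STRONGER than print, this
pinned one is print's statement (reader's verdict word VERBATIM-SPECIALISED; flag `HPMC-Manin-normalisation`, priced by the
desks). The bridge `thmB_imc1_charIdeal_torsion_eq_heegnerCharIdeal_sq_minimal_OPEN_of_unpinned` (unpinned ⇒ pinned) is PROVED, so nothing is asserted beyond the declaration above;
divisibility-shaped binders are unaffected (r19 ADD-5 §4.3).
NEVER cite this `Prop` as a theorem: take it as an explicit hypothesis; a result using it is conditional on
unrefereed claims.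
[claim: KellerYin2024, status: under-review]
[cite: CastellaGrossiSkinner2025, Theorem C (§0.1) = Cor. 5.5.4 (the transcription reused; shape only)]
[cite: Howard2004HeegnerKolyvagin, Thm. 3.3.7 (transcription of Λκ_∞ as the Heegner module 𝐇)]
[cite: PerrinRiou1987BSMF, §1 Conj. B p. 405 (the factor c_π · u)] [cite: BurungaleCastellaKim2021, Remark after Conj. 1 (the factor c_π · #𝒪_K^× / 2; Mazur for p ∤ N)] -/
def thmB_imc1_charIdeal_torsion_eq_heegnerCharIdeal_sq_minimal_OPEN [W.IsGloballyMinimal] : Prop :=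
  ∀ (_ : ThmBHypotheses N W K p κ γ) (D : (W.baseChange K).LambdaAdicSelmerData κ γ)
    (F : HeegnerFamily N W K κ jbar)
    -- PINNED (fix F1): `F.Dt` has minimal modular degree (`φ = ±φ_min`) — verbatim the body of
    -- `ModularForms.ModularParametrizationData.IsMinimal F.Dt` (`ModularParametrizationScalingProofs.lean`)
    (_ : ∀ Dt' : ModularForms.ModularParametrizationData W N, F.Dt.deg ≤ Dt'.deg)
    -- PINNED (fix F1′, the Manin pin — rider R-b): the parametrisation's Manin constant is a `p`-adic unit
    (_ : ¬ (p : ℤ) ∣ F.Dt.c)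
    (X : (W.baseChange K).SelmerDualData κ γ),
    (Module.Finite (IwasawaAlgebra p) D.S ∧ Module.finrank (IwasawaAlgebra p) D.S = 1) ∧
    (Module.Finite (IwasawaAlgebra p) X.X ∧ Module.finrank (IwasawaAlgebra p) X.X = 1 ∧
      Module.charIdeal (IwasawaAlgebra p) (Submodule.torsion (IwasawaAlgebra p) X.X) =
        heegnerCharIdeal D F ^ 2)

variable {N W K p κ γ jbar}

/-- **Bridge, PROVED**: the unpinned `thmB_imc1_charIdeal_torsion_eq_heegnerCharIdeal_sq_OPEN` implies its pinned twin (the two extra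
hypotheses are discarded) — so the twin is a WEAKENING, never a strengthening. [claim: KellerYin2024, status: under-review] -/
theorem thmB_imc1_charIdeal_torsion_eq_heegnerCharIdeal_sq_minimal_OPEN_of_unpinned [W.IsGloballyMinimal]
    (h : thmB_imc1_charIdeal_torsion_eq_heegnerCharIdeal_sq_OPEN N W K p κ γ jbar) :
    thmB_imc1_charIdeal_torsion_eq_heegnerCharIdeal_sq_minimal_OPEN N W K p κ γ jbar :=
  fun hyp D F _ _ X ↦ h hyp D F X

/-- **Theorem B ⇒ the divisibility of Howard's Theorem B (c)** in the (possibly anomalous)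
Eisenstein setting: `char_Λ(𝒳_tors) ∣ char_Λ(𝔖/𝐇)²` — the "upper bound" half, in exactly the form
of the third clause of the tree's `Howard2004_thmB` (the half a Kolyvagin-system argument gives;
KY Thm. 3.0.5 (ii)). CONDITIONAL on the OPEN fact. [claim: KellerYin2024, status: under-review] -/
theorem charIdeal_torsion_dvd_of_thmB_OPEN
    (h : thmB_imc1_charIdeal_torsion_eq_heegnerCharIdeal_sq_OPEN N W K p κ γ jbar)
    (hyp : ThmBHypotheses N W K p κ γ) (D : (W.baseChange K).LambdaAdicSelmerData κ γ)
    (F : HeegnerFamily N W K κ jbar) (X : (W.baseChange K).SelmerDualData κ γ) :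
    Module.charIdeal (IwasawaAlgebra p) (Submodule.torsion (IwasawaAlgebra p) X.X) ∣
      heegnerCharIdeal D F ^ 2 :=
  dvd_of_eq (h hyp D F X).2.2.2

/-- **Theorem B ⇒ the "lower bound" half** `char_Λ(𝔖/𝐇)² ∣ char_Λ(𝒳_tors)` (the divisibility that
in print comes from the equality via the `λ`/`μ` comparison, KY Thms. 1.5.1 / 2.2.3). CONDITIONAL on
the OPEN fact. [claim: KellerYin2024, status: under-review] -/
theorem heegnerCharIdeal_sq_dvd_of_thmB_OPEN
    (h : thmB_imc1_charIdeal_torsion_eq_heegnerCharIdeal_sq_OPEN N W K p κ γ jbar)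
    (hyp : ThmBHypotheses N W K p κ γ) (D : (W.baseChange K).LambdaAdicSelmerData κ γ)
    (F : HeegnerFamily N W K κ jbar) (X : (W.baseChange K).SelmerDualData κ γ) :
    heegnerCharIdeal D F ^ 2 ∣
      Module.charIdeal (IwasawaAlgebra p) (Submodule.torsion (IwasawaAlgebra p) X.X) :=
  dvd_of_eq (h hyp D F X).2.2.2.symm

variable [W.IsGloballyMinimal]
  -- the sibling's bundle reads `a_p` (`¬ Anom W p`, `GoodOrd W p`) on a globally minimal model

omit [NeZero N] in

/-- The hypotheses of the PUBLISHED Theorem C (Castella–Grossi–Skinner 2025) imply those of Keller–Yin's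
Theorem B: drop `¬ Anom W p`. [cite: CastellaGrossiSkinner2025, Theorem C (§0.1)] -/
theorem ThmBHypotheses.of_thmC (hyp : ThmCHypotheses N W K p κ γ) : ThmBHypotheses N W K p κ γ where
  isElliptic := hyp.isElliptic
  level := hyp.level
  two_lt := hyp.two_lt
  good := hyp.good
  red := hyp.red
  isImaginaryQuadratic := hyp.isImaginaryQuadratic
  heegner := hyp.heegner
  discr_odd := hyp.discr_odd
  discr_ne := hyp.discr_ne
  split := hyp.split
  not_dvd_classNumber := hyp.not_dvd_classNumber
  anticyclotomic := hyp.anticyclotomic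
  topGenerator := hyp.topGenerator

omit [NeZero N] in
/-- Keller–Yin's hypotheses together with non-anomaly `¬ Anom W p` ("`φ|_{G_p} ≠ 𝟙, ω`", tree theorem
`not_anom_iff_cgs_of_mem_primesAbove`) are exactly the hypotheses of the PUBLISHED Theorem C.
[cite: CastellaGrossiSkinner2025, Theorem C (§0.1)] -/
theorem ThmBHypotheses.toThmC (hyp : ThmBHypotheses N W K p κ γ) (hna : ¬ Anom W p) :
    ThmCHypotheses N W K p κ γ where
  isElliptic := hyp.isElliptic
  level := hyp.level
  two_lt := hyp.two_lt
  good := hyp.good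
  red := hyp.red
  not_anom := hna
  isImaginaryQuadratic := hyp.isImaginaryQuadratic
  heegner := hyp.heegner
  discr_odd := hyp.discr_odd
  discr_ne := hyp.discr_ne
  split := hyp.split
  not_dvd_classNumber := hyp.not_dvd_classNumber
  anticyclotomic := hyp.anticyclotomic
  topGenerator := hyp.topGenerator

omit [NeZero N] in
/-- The hypotheses of Theorem B make `p` ODD and of good ORDINARY reduction ("`p > 2` an ordinary
Eisenstein prime not dividing `N`"; §0.1 L228: "For elliptic curves, good Eisenstein primes are known
to be ordinary"): `p ≠ 2` from `2 < p`, ordinarity from the tree theorem `goodOrd_of_red_of_good`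
(Serre 1972 Prop. 12). [claim: KellerYin2024, status: under-review] -/
theorem ThmBHypotheses.p_ne_two_and_goodOrd (hyp : ThmBHypotheses N W K p κ γ) :
    p ≠ 2 ∧ GoodOrd W p :=
  haveI := hyp.isElliptic
  ⟨by have := hyp.two_lt; omega, goodOrd_of_red_of_good W p hyp.two_lt hyp.good hyp.red⟩

/-- **Keller–Yin's Theorem B CONTAINS the PUBLISHED Castella–Grossi–Skinner 2025 Theorem C**
(`thmC_charIdeal_torsion_eq_heegnerCharIdeal_sq`): the claim has the same conclusion under fewer
hypotheses (§0.6: "removing the technical condition `θ|_{G_p} ≠ 𝟙, ω`"). A CONSISTENCY statement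
between a claim and a theorem of the literature; nothing asserted.
[claim: KellerYin2024, status: under-review] [cite: CastellaGrossiSkinner2025, Theorem C = Cor. 5.5.4] -/
theorem thmC_of_thmB_OPEN (h : thmB_imc1_charIdeal_torsion_eq_heegnerCharIdeal_sq_OPEN N W K p κ γ jbar) :
    thmC_charIdeal_torsion_eq_heegnerCharIdeal_sq N W K p κ γ jbar :=
  fun hyp D F X ↦ h (ThmBHypotheses.of_thmC hyp) D F X

/-- **At a NON-ANOMALOUS prime the claim is the published theorem**: if `¬ Anom W p`
(`a_p ≢ 1 (mod p)`, i.e. `φ|_{G_p} ≠ 𝟙, ω`), Theorem B for `(E, p, K)` follows from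
Castella–Grossi–Skinner 2025 Theorem C. So the OPEN content of
`thmB_imc1_charIdeal_torsion_eq_heegnerCharIdeal_sq_OPEN` is exactly the anomalous case.
[cite: CastellaGrossiSkinner2025, Theorem C = Cor. 5.5.4] -/
theorem thmB_OPEN_of_thmC_of_not_anom (hna : ¬ Anom W p)
    (hC : thmC_charIdeal_torsion_eq_heegnerCharIdeal_sq N W K p κ γ jbar) :
    thmB_imc1_charIdeal_torsion_eq_heegnerCharIdeal_sq_OPEN N W K p κ γ jbar :=
  fun hyp D F X ↦ hC (hyp.toThmC hna) D F X

end Literature.NumberTheory.EllipticCurves.KellerYin2024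

end
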